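import Literature.AlgebraicGeometry.HodgeTheory.ProjectiveArithmeticallyCohenMacaulayDegree
import Literature.AlgebraicGeometry.HodgeTheory.ProjectiveDegreePositiveInteger
import HarnessLib

/-!
# Minimal degree `deg X = codim X + 1` ⟺ `2`-regular, for arithmetically Cohen–Macaulay `X`
# (Eisenbud–Goto 1984)

Eisenbud–Goto, *Linear free resolutions and minimal multiplicity* (J. Algebra 88, 1984),
Introduction: "if `R = S/I` is either Cohen–Macaulay, or geometrically integral …, then there is an
inequality connecting the multiplicity or degree `δ(R)` … and the codimension
`codim R = dim_k R_1 - dim R` …: `δ(R) ≥ 1 + codim R`. The case of equality ("minimal" degree or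
multiplicity …) is very special; in this case `R` is automatically Cohen–Macaulay …, `I` is
generated by forms of degree `≤ 2`, and … `I` has a linear free resolution"; **Thm. 1.2**: "`R` has
`p`-linear resolution if and only if `R` is `p`-regular"; **Thm. 2.1** (the inequality),
**Thm. 3.1 (a)** (minimal multiplicity ⟺ linear resolution, Cohen–Macaulay case). Eisenbud, GoS
**Cor. 4.15** is the inequality `reg S_X ≤ deg X - codim X` for `S_X` Cohen–Macaulay.

In the tree's Čech language (`Literature/Algebra/Homology/LaurentCech*`; `X = V(I) ⊆ ℙ^r`,
`I ⊆ S = k[x₀, …, x_r]` graded, `k` infinite, `r ≥ 2`; "arithmetically Cohen–Macaulay" = a linear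
regular sequence `ℓ_1, …, ℓ_{t+1}` on `S ⧸ I`, `t = dim X = deg P_X`; `deg X = t!·lc(P_X)`;
`codim R = codim X - dim_k I_1`; `2`-regularity of `𝓘_X` = `H^i(𝓘_X(2 - i)) = 0`, `i ≥ 1`, i.e.
`reg S_X ≤ 1`, i.e. `S_X` has a `2`-linear resolution):

* `finrank_quotient_degPiece_zero_eq_one_of_ne_top` — `H_{S/J}(0) = 1` for `J ≠ S`;
* `finrank_quotient_degPiece_one_add_length_eq` — `H_{S/(I, ℓ_1, …, ℓ_s)}(1) + s = H_{S/I}(1)`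
  along a linear regular sequence (`h_1 = codim X - dim I_1` for the `h`-vector);
* **`degree_eq_codim_add_one_iff_two_regular`** — for `X` arithmetically Cohen–Macaulay with
  `P_X ≠ 0`: **`deg X = codim X + 1 - dim_k I_1` iff `𝓘_X` is `2`-regular**; both sides say that the
  `h`-vector `(1, codim X - dim I_1, h_2, …)` of the Artinian reduction `S ⧸ (I, ℓ_1, …, ℓ_{t+1})`
  vanishes from degree `2` on (`deg X = Σ_n h_n`, `ProjectiveArithmeticallyCohenMacaulayDegree`;
  `𝓘_X` `m`-regular iff `h_n = 0` for `n ≥ m`,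
  `ProjectiveArithmeticallyCohenMacaulayExactRegularity`).

Theorems only; no definitions, no named facts. (The equality characterises the varieties of
minimal degree — quadric hypersurfaces, rational normal scrolls, the Veronese surface, cones over
these — by del Pezzo–Bertini; that classification is not formalised here.)

## References

* [EisenbudGoto1984] D. Eisenbud, S. Goto, *Linear free resolutions and minimal multiplicity*,
  J. Algebra 88 (1984), 89–133: Introduction (p. 90), Thm. 1.2, Cor. 1.5, Thm. 2.1, Thm. 3.1.
* [Eisenbud2005] D. Eisenbud, *The Geometry of Syzygies*, GTM 229 (2005), Prop. 4.14, Cor. 4.15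
  (PDF pp. 100–101).
* [Hartshorne1977] R. Hartshorne, *Algebraic Geometry*, GTM 52 (1977), I §7 (pp. 49–53).
-/

noncomputable section

open CategoryTheory CategoryTheory.Limits Polynomial Pointwise
open scoped Nat

universe u

namespace Literature.Algebra.Homology

namespace LaurentCech

open OrderedCech TopCohomology

variable {k : Type u} [Field k] {r : ℕ}

/-- **`H_{S/I}(0) = 1` for a proper graded ideal**: `dim_k S_0 ⧸ I_0 = 1` unless `I = S` (a
degree-`0` element of `I` is a non-zero constant, a unit). [cite: Hartshorne1977, I §7 (p. 49)] -/
theorem finrank_quotient_degPiece_zero_eq_one_of_ne_top {I : Submodule (P k r) (Unit → P k r)}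
    (hI : I ≠ ⊤) :
    Module.finrank k ((Unit → (Ldeg k r (0 - 0)).comap (toL k r).toLinearMap) ⧸
        degPiece (fun _ : Unit => (0 : ℤ)) I 0) = 1 := by
  have h1 := finrank_quotient_degPiece_add_finrank_eq_choose I (d := 0) le_rfl
  rw [Int.toNat_zero, zero_add, Nat.choose_self] at h1
  suffices hbot : degPiece (fun _ : Unit => (0 : ℤ)) I 0 = ⊥ by
    have h0 : Module.finrank k ↥(degPiece (fun _ : Unit => (0 : ℤ)) I 0) = 0 := by
      rw [hbot]; exact finrank_bot k _
    omega
  rw [eq_bot_iff]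
  intro q hq
  rw [Submodule.mem_bot]
  by_contra hq0
  have hmem : (fun j => (q j : P k r)) ∈ I := (mem_degPiece _ _).1 hq
  set c : P k r := (q () : P k r) with hcdef
  have hchom : c.IsHomogeneous 0 := by
    have h2 : c ∈ (Ldeg k r ((0 : ℤ) - 0)).comap (toL k r).toLinearMap := (q ()).2
    rw [Submodule.mem_comap, sub_zero] at h2
    exact (toL_mem_Ldeg_iff c 0).1 h2
  have hc0 : c ≠ 0 := by
    intro h0
    apply hq0
    funext u
    apply Subtype.ext
    cases u
    rw [← hcdef, h0]
    rfl
  obtain ⟨d, hd⟩ : ∃ d : k, c = MvPolynomial.C d :=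
    ⟨c.coeff 0, MvPolynomial.totalDegree_eq_zero_iff_eq_C.1
      (le_antisymm hchom.totalDegree_le (Nat.zero_le _))⟩
  have hd0 : d ≠ 0 := by
    intro h; apply hc0; rw [hd, h, map_zero]
  apply hI
  rw [eq_top_iff]
  intro v _
  have hv : v = (v () * MvPolynomial.C d⁻¹) • (fun j => (q j : P k r)) := by
    funext u
    cases u
    rw [Pi.smul_apply, smul_eq_mul]
    change v () = v () * MvPolynomial.C d⁻¹ * c
    rw [hd, mul_assoc, ← map_mul, inv_mul_cancel₀ hd0, map_one, mul_one]
  rw [hv]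
  exact I.smul_mem _ hmem

/-- **Each cut by a linear non-zero-divisor removes exactly one dimension from the space of linear
forms modulo the ideal**: for `I ⊆ S` graded and linear forms `ℓ_1, …, ℓ_s` with `ℓ_{i+1}` a
non-zero-divisor modulo `I + (ℓ_1, …, ℓ_i)` and `I + (ℓ_1, …, ℓ_s) ≠ S`:
`H_{S/(I, ℓ_1, …, ℓ_s)}(1) + s = H_{S/I}(1)` (the exact recursion `H_{M/ℓM}(1) = H_M(1) - H_M(0)`
with `H_M(0) = 1`). [cite: Eisenbud2005, Cor. 4.15 (proof, PDF p. 101)]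
[cite: EisenbudGoto1984, Cor. 1.5] -/
theorem finrank_quotient_degPiece_one_add_length_eq :
    ∀ (ls : List (P k r)) {I : Submodule (P k r) (Unit → P k r)},
      IsGraded (fun _ : Unit => (0 : ℤ)) I → (∀ ℓ ∈ ls, toL k r ℓ ∈ Ldeg k r 1) →
      (∀ (l₁ : List (P k r)) (ℓ : P k r) (l₂ : List (P k r)), ls = l₁ ++ ℓ :: l₂ →
        ∀ v : Unit → P k r, ℓ • v ∈ I ⊔ Ideal.ofList l₁ • (⊤ : Submodule (P k r) (Unit → P k r)) →
          v ∈ I ⊔ Ideal.ofList l₁ • (⊤ : Submodule (P k r) (Unit → P k r))) →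
      I ⊔ Ideal.ofList ls • (⊤ : Submodule (P k r) (Unit → P k r)) ≠ ⊤ →
      Module.finrank k ((Unit → (Ldeg k r (1 - 0)).comap (toL k r).toLinearMap) ⧸
          degPiece (fun _ : Unit => (0 : ℤ))
            (I ⊔ Ideal.ofList ls • (⊤ : Submodule (P k r) (Unit → P k r))) 1) + ls.length =
        Module.finrank k ((Unit → (Ldeg k r (1 - 0)).comap (toL k r).toLinearMap) ⧸
          degPiece (fun _ : Unit => (0 : ℤ)) I 1) := by
  intro ls
  induction ls with
  | nil =>
    intro I hI hls hreg hne
    rw [Ideal.ofList_nil, Submodule.bot_smul, sup_bot_eq, List.length_nil, add_zero]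
  | cons ℓ ls' ih =>
    intro I hI hls hreg hne
    have hℓ : toL k r ℓ ∈ Ldeg k r 1 := hls ℓ (by simp)
    have hregK : ∀ v : Unit → P k r, ℓ • v ∈ I → v ∈ I := by
      intro v hv
      have h := hreg [] ℓ ls' rfl v
      rw [Ideal.ofList_nil, Submodule.bot_smul, sup_bot_eq] at h
      exact h hv
    have hK₁eq : (I ⊔ ℓ • ⊤) ⊔ Ideal.ofList ls' • (⊤ : Submodule (P k r) (Unit → P k r)) =
        I ⊔ Ideal.ofList (ℓ :: ls') • ⊤ := by
      rw [Ideal.ofList_cons_smul, sup_assoc]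
    have hIne : I ≠ ⊤ := by
      intro h; apply hne; rw [h]; exact top_sup_eq _
    have hreg₁ : ∀ (l₁ : List (P k r)) (ℓ' : P k r) (l₂ : List (P k r)),
        ls' = l₁ ++ ℓ' :: l₂ → ∀ v : Unit → P k r,
          ℓ' • v ∈ (I ⊔ ℓ • ⊤) ⊔ Ideal.ofList l₁ • (⊤ : Submodule (P k r) (Unit → P k r)) →
          v ∈ (I ⊔ ℓ • ⊤) ⊔ Ideal.ofList l₁ • (⊤ : Submodule (P k r) (Unit → P k r)) := by
      intro l₁ ℓ' l₂ hsplit v hv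
      have h := hreg (ℓ :: l₁) ℓ' l₂ (by rw [hsplit]; rfl) v
      rw [Ideal.ofList_cons_smul, ← sup_assoc] at h
      exact h hv
    have hih := ih (isGraded_sup_smul_top _ hI hℓ) (fun ℓ' hℓ' => hls ℓ' (List.mem_cons_of_mem _
    hℓ'))
      hreg₁ (by rw [hK₁eq]; exact hne)
    rw [hK₁eq] at hih
    have hrec := finrank_quotient_degPiece_sup_smul_top_add_eq (fun _ : Unit => (0 : ℤ)) hI hℓ hregK
      0 1 (by norm_num)
    rw [finrank_quotient_degPiece_zero_eq_one_of_ne_top hIne] at hrec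
    rw [List.length_cons, ← hrec, ← hih]
    ring

/-- **Minimal degree ⟺ `2`-regular, for arithmetically Cohen–Macaulay `X ⊆ ℙ^r`** (Eisenbud–Goto:
"`δ(R) ≥ 1 + codim R`. The case of equality ("minimal" degree …) is very special; in this case
… `I` has a linear free resolution", Thm. 3.1 with Thm. 1.2 "`R` has `p`-linear resolution if and
only if `R` is `p`-regular"; the inequality is Eisenbud, GoS Cor. 4.15). For `X = V(I)`, `I ⊆ S`
graded with Hilbert polynomial `Q ≠ 0` of degree `t`, linear forms `ℓ_1, …, ℓ_{t+1}` forming a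
regular sequence on `S ⧸ I` (`k` infinite, `r ≥ 2`), and `B` beyond which the Artinian reduction
`R = S ⧸ (I, ℓ_1, …, ℓ_{t+1})` vanishes: **`deg X = codim X + 1 - dim_k I_1` (equality in
`degree_ge_codim_of_linearRegularSequence`) iff `𝓘_X` is `2`-regular** — both say that the
`h`-vector `(dim R_0, dim R_1, dim R_2, …) = (1, codim X - dim I_1, …)` vanishes from degree `2` on
(`deg X = Σ_n dim R_n`, `ProjectiveArithmeticallyCohenMacaulayDegree`; `𝓘_X` `m`-regular iff
`R_n = 0` for `n ≥ m`, `ProjectiveArithmeticallyCohenMacaulayExactRegularity`).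
[cite: EisenbudGoto1984, Introduction (p. 90), Thm. 1.2, Thm. 2.1, Thm. 3.1 (a)]
[cite: Eisenbud2005, Cor. 4.15 (PDF p. 101), Prop. 4.14 (PDF p. 100)] -/
theorem degree_eq_codim_add_one_iff_two_regular [Infinite k] (hr : 2 ≤ r) (t : ℕ)
    (ls : List (P k r)) {I : Submodule (P k r) (Unit → P k r)}
    (hI : IsGraded (fun _ : Unit => (0 : ℤ)) I) (hls : ∀ ℓ ∈ ls, toL k r ℓ ∈ Ldeg k r 1)
    (hreg : ∀ (l₁ : List (P k r)) (ℓ : P k r) (l₂ : List (P k r)), ls = l₁ ++ ℓ :: l₂ →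
      ∀ v : Unit → P k r, ℓ • v ∈ I ⊔ Ideal.ofList l₁ • (⊤ : Submodule (P k r) (Unit → P k r)) →
        v ∈ I ⊔ Ideal.ofList l₁ • (⊤ : Submodule (P k r) (Unit → P k r)))
    (hlen : ls.length = t + 1) {Q : ℚ[X]}
    (hQ : ∀ n : ℤ, ((∑ q ∈ Finset.range (r + 1), (-1 : ℤ) ^ q *
      (Module.finrank k ((quot (fun _ : Unit => (0 : ℤ)) I n).homology q) : ℤ) : ℤ) : ℚ) =
        Q.eval (n : ℚ))
    (hQt : Q.natDegree = t) (hQ0 : Q ≠ 0) {B : ℕ}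
    (hB : ∀ n : ℤ, (B : ℤ) < n →
      degPiece (fun _ : Unit => (0 : ℤ))
        (I ⊔ Ideal.ofList ls • (⊤ : Submodule (P k r) (Unit → P k r))) n = ⊤) :
    (t ! : ℚ) * Q.leadingCoeff + t + Module.finrank k (degPiece (fun _ : Unit => (0 : ℤ)) I 1) =
        r + 1 ↔
      ∀ i : ℤ, 1 ≤ i → IsZero ((cech (fun _ : Unit => (0 : ℤ)) I (2 - i)).homology i) := by
  have hr1 : 1 ≤ r := one_le_two.trans hr
  haveI hfin : ∀ d : ℤ, Module.Finite k (Unit → (Ldeg k r (d - 0)).comap (toL k r).toLinearMap) :=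
    fun d => moduleFinite_pi_comap_toL_Ldeg (k := k) (r := r) (fun _ : Unit => (0 : ℤ)) d
  -- the `h`-vector
  set h : ℕ → ℕ := fun n => Module.finrank k ((Unit → (Ldeg k r ((n : ℤ) - 0)).comap
    (toL k r).toLinearMap) ⧸ degPiece (fun _ : Unit => (0 : ℤ))
      (I ⊔ Ideal.ofList ls • (⊤ : Submodule (P k r) (Unit → P k r))) n) with hhdef
  have hB' : ∀ n : ℤ, ((B + 2 : ℕ) : ℤ) < n →
      degPiece (fun _ : Unit => (0 : ℤ))
        (I ⊔ Ideal.ofList ls • (⊤ : Submodule (P k r) (Unit → P k r))) n = ⊤ :=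
    fun n hn => hB n (by push_cast at hn; omega)
  -- `deg X = Σ_{n ≤ B + 2} h n`
  have hdeg := degree_eq_sum_finrank_artinianReduction_ideal hr1 t ls hI hls hreg hlen hQ hQt hB'
  have hdeg' : (t ! : ℚ) * Q.leadingCoeff = ((∑ n ∈ Finset.range (B + 2 + 1), h n : ℕ) : ℚ) := by
    rw [hdeg]; push_cast; rfl
  -- `h n = 0 ⟺ R_n = S_n`
  have hzero : ∀ n : ℕ, h n = 0 ↔ degPiece (fun _ : Unit => (0 : ℤ))
      (I ⊔ Ideal.ofList ls • (⊤ : Submodule (P k r) (Unit → P k r))) n = ⊤ := by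
    intro n
    have hq := Submodule.finrank_quotient_add_finrank (degPiece (fun _ : Unit => (0 : ℤ))
      (I ⊔ Ideal.ofList ls • (⊤ : Submodule (P k r) (Unit → P k r))) (n : ℤ))
    constructor
    · intro h0
      exact Submodule.eq_top_of_finrank_eq (by simp only [hhdef] at h0; omega)
    · intro htop
      have : Module.finrank k ↥(degPiece (fun _ : Unit => (0 : ℤ))
          (I ⊔ Ideal.ofList ls • (⊤ : Submodule (P k r) (Unit → P k r))) (n : ℤ)) =
          Module.finrank k (Unit → (Ldeg k r ((n : ℤ) - 0)).comap (toL k r).toLinearMap) := by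
        rw [htop]; exact finrank_top _ _
      simp only [hhdef]
      omega
  -- `R ≠ 0` (as `deg X > 0`), so `h 0 = 1`
  have hne : I ⊔ Ideal.ofList ls • (⊤ : Submodule (P k r) (Unit → P k r)) ≠ ⊤ := by
    intro htop
    have hall : ∀ n : ℕ, h n = 0 := fun n => (hzero n).2 (by
      rw [htop]
      exact eq_top_iff.2 fun q _ => by rw [mem_degPiece]; exact Submodule.mem_top)
    have hlc := leadingCoeff_hilbertPolynomial_pos (fun _ : Unit => (0 : ℤ)) hr1 hI hQ hQ0
    have h0 : (t ! : ℚ) * Q.leadingCoeff = 0 := by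
      rw [hdeg']; simp [hall]
    have htpos : (0 : ℚ) < t ! := by exact_mod_cast Nat.factorial_pos t
    nlinarith
  have hh0 : h 0 = 1 := by
    simp only [hhdef]
    exact_mod_cast finrank_quotient_degPiece_zero_eq_one_of_ne_top hne
  -- `h 1 + (t + 1) = H_I(1)` and `H_I(1) + dim I_1 = r + 1`
  have hh1 := finrank_quotient_degPiece_one_add_length_eq ls hI hls hreg hne
  rw [hlen] at hh1
  have hh1' : h 1 = Module.finrank k ((Unit → (Ldeg k r (1 - 0)).comap (toL k r).toLinearMap) ⧸
      degPiece (fun _ : Unit => (0 : ℤ))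
        (I ⊔ Ideal.ofList ls • (⊤ : Submodule (P k r) (Unit → P k r))) 1) := by
    simp only [hhdef]
    rw [Nat.cast_one]
  rw [← hh1'] at hh1
  have hI1 := finrank_quotient_degPiece_add_finrank_eq_choose I (d := 1) zero_le_one
  rw [Int.toNat_one, add_comm 1 r, Nat.choose_succ_self_right] at hI1
  -- split off `h 0` and `h 1`
  have hsplit : ∑ n ∈ Finset.range (B + 2 + 1), h n =
      ∑ i ∈ Finset.range (B + 1), h (i + 2) + h 1 + h 0 := by
    rw [Finset.sum_range_succ', Finset.sum_range_succ']
  -- `2`-regularity as vanishing of the `h`-vector from degree `2` on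
  rw [regular_cech_iff_of_linearRegularSequence_ideal hr t ls hI hls hreg hlen hQ hQt
    (m := 2) (by norm_num)]
  constructor
  · intro heq n hn
    -- the sum `Σ_{i ≤ B} h (i + 2)` vanishes
    have hsum0 : ∑ i ∈ Finset.range (B + 1), h (i + 2) = 0 := by
      have h' : ((∑ n ∈ Finset.range (B + 2 + 1), h n : ℕ) : ℚ) + t +
          Module.finrank k ↥(degPiece (fun _ : Unit => (0 : ℤ)) I 1) = r + 1 := by
        rw [← hdeg']; exact heq
      have h'' : (∑ n ∈ Finset.range (B + 2 + 1), h n) + t +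
          Module.finrank k ↥(degPiece (fun _ : Unit => (0 : ℤ)) I 1) = r + 1 := by
        exact_mod_cast h'
      rw [hsplit, hh0] at h''
      omega
    rcases le_or_gt n ((B + 2 : ℕ) : ℤ) with hle | hgt
    · obtain ⟨i, rfl⟩ : ∃ i : ℕ, n = ((i + 2 : ℕ) : ℤ) := ⟨(n - 2).toNat, by push_cast; omega⟩
      have hi : i ∈ Finset.range (B + 1) := Finset.mem_range.2 (by push_cast at hle; omega)
      exact (hzero (i + 2)).1 (Finset.sum_eq_zero_iff.1 hsum0 i hi)
    · exact hB' n hgt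
  · intro hvan
    have hsum0 : ∑ i ∈ Finset.range (B + 1), h (i + 2) = 0 :=
      Finset.sum_eq_zero fun i _ => (hzero (i + 2)).2 (hvan _ (by push_cast; omega))
    have h'' : (∑ n ∈ Finset.range (B + 2 + 1), h n) + t +
        Module.finrank k ↥(degPiece (fun _ : Unit => (0 : ℤ)) I 1) = r + 1 := by
      rw [hsplit, hsum0, hh0, zero_add]
      omega
    rw [hdeg']
    exact_mod_cast h''

end LaurentCech

end Literature.Algebra.Homology

end
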